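import Literature.Barriers.RiemannHypothesis.DavenportHeilbronnSeries
import Literature.NumberTheory.LFunctions.MertensElementary
import Mathlib.NumberTheory.Bertrand
import Mathlib.NumberTheory.PrimeCounting
import Mathlib.Analysis.Complex.LocallyUniformLimit
import Mathlib.Analysis.SpecialFunctions.Pow.Deriv
import Mathlib.Analysis.SpecialFunctions.Trigonometric.Bounds
import Mathlib.Analysis.Complex.ExponentialBounds
import HarnessLib

/-!
# A dithered completely multiplicative twist of `ζ_N` with a finite-frequency mean (toward Montgomery 1983)

Barrier catalogue `Literature/Barriers/RiemannHypothesis/`, companion of `TuranPartialSums.lean` (named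
fact `Montgomery1983_theorem`: for `0 < c < 4/π − 1` and `N > N₀(c)` the section `ζ_N` has zeros with
`σ > 1 + c log log N/log N`) and of `TuranPartialSumsBohr.lean` (its reduction to zeros of TWISTED
sections `F_N(s) = Σ_{n ≤ N} ψ(n) n^{−s}`, `ψ` completely multiplicative and unimodular at the primes:
`Montgomery1983_theorem_of_twisted_zeros`). Definitions + theorems, no named facts.

## The construction (a variant of Montgomery's §2 with finitely many singularities)

Montgomery takes `a(p) = b_δ(log p/2π)` with a unimodular `1`-periodic `b_δ` whose Fourier series
converges absolutely; then `Σ a(n)n^{−s} ≍ Π_{k ∈ ℤ} ζ(s − ik)^{b̂_δ(k)}` has branch points at ALL the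
points `1 + ik`, and §3 of the source truncates the product at `|k| ≤ K = exp((log log N)²)` with
de la Vallée Poussin's region of width `c₁/(3 log K)` (Lemmas 2–4). The variant vendored here keeps
the extremal mechanism (the constant `4/π` is `∫_0^1 |e(ϑ) − 1| dϑ`) but makes the set of singularities
FINITE and independent of `N`, at the price of a harmless extra factor analytic on `Re s > 0`:

* the *mean* `m(x) = i e^{ix} r(x)` with a REAL profile `r`, `|r| ≤ 1 − δ` (in the application `r` is
  `(1 − δ) ×` a Fejér mean of the square wave `sgn(sin x)`, a finite sine polynomial, so that
  `m(log p/2) = Σ_{n ∈ S} μ_n p^{in}` with `S ⊆ ℤ` finite — `Literature/Analysis/Fourier/FejerSquareWave.lean`);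
* the *dither* `w(x) = −e^{ix} √(1 − r(x)²)`, for which `m(x) ± w(x)` are unimodular
  (`norm_mean_add_dither`, `norm_mean_sub_dither`);
* the twist `ψ(p_k) = m(x_k) + (−1)^k w(x_k)`, `x_k = (log p_k)/2`, along the increasing enumeration
  `p_0 = 2 < p_1 = 3 < …` of the primes (Mathlib's `Nat.nth Nat.Prime`), extended completely
  multiplicatively (`Profile.twist`, via the tree's `complMul`): `|ψ(p)| = 1` (`norm_ditheredTwist_prime`).

Then `Σ_p ψ(p) p^{−s} = Σ_{n ∈ S} μ_n Σ_p p^{in−s} + A(s)` where the alternating prime series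
`A(s) = Σ_k (−1)^k w(x_k) p_k^{−s}` — grouped in consecutive pairs, `ditherSeries` — converges and is
HOLOMORPHIC on `Re s > 0` (`differentiableOn_ditherSeries`; pairs are
`≪ (|s| + L)(p_{2j+1} − p_{2j}) p_{2j}^{−σ−1}` by Bertrand's postulate and the Lipschitz bound for `w`)
and satisfies, in the strip `1 − 1/log(|t|+3) ≤ σ ≤ 2`,
`‖A(s)‖ ≤ 6 log log(2|t| + 6) + C` (`exists_norm_ditherSeries_le`: the primes `p ≤ 2(|t|+3)` are
summed trivially with Mertens' `Σ_{p ≤ y} 1/p ≤ log log y + 4`, the rest in pairs), so that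
`|exp A(s)| ≤ e^C (log(2|t|+6))^6` grows only like a power of `log t`: the extra Euler factor is harmless
in the contour argument of §4, while the singular part `Π_{n ∈ S} ζ(s − in)^{μ_n}` is a finite product
(`Literature/NumberTheory/LFunctions/LogZetaClassicalRegion.lean`, `zetaCpow`).

## References

* [Montgomery1983] H. L. Montgomery, *Zeros of approximations to the zeta function*, Studies in Pure
  Mathematics (Birkhäuser 1983), 497–506: §2 (the twist `a(p) = b(log p/2π)`, (3)–(5), (10)–(13)),
  §3 ((14)–(16): splitting off an absolutely convergent factor).
* [MontgomeryVaughan2001] H. L. Montgomery, R. C. Vaughan, *Mean values of multiplicative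
  functions*, Period. Math. Hungar. 43 (2001), Lemma 2 (the same extremal constant `4/π`).
* [HardyWright2008] G. H. Hardy, E. M. Wright, *An Introduction to the Theory of Numbers*, 6th ed.,
  Thm. 427 (Mertens), Thm. 418 (Bertrand's postulate).
-/

noncomputable section

open Complex Filter Topology Set

namespace Literature.Barriers.RiemannHypothesis

namespace DitheredTwist

/-! ### The increasing enumeration of the primes -/

local notation "p[" k "]" => Nat.nth Nat.Prime k

/-- `2 ≤ p_k`, as a real number. [folklore] -/
private theorem two_le_nth_prime_real (k : ℕ) : (2 : ℝ) ≤ p[k] := by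
  exact_mod_cast (Nat.prime_nth_prime k).two_le

/-- `0 < p_k`, as a real number. [folklore] -/
private theorem nth_prime_pos_real (k : ℕ) : (0 : ℝ) < p[k] :=
  zero_lt_two.trans_le (two_le_nth_prime_real k)

/-- **Bertrand's postulate along the enumeration** of the primes `p_k = Nat.nth Nat.Prime k`:
`p_{k+1} ≤ 2 p_k`. [cite: HardyWright2008, Thm. 418] -/
theorem nth_prime_succ_le_two_mul (k : ℕ) : p[k + 1] ≤ 2 * p[k] := by
  obtain ⟨q, hq, hlt, hle⟩ := Nat.exists_prime_lt_and_le_two_mul (p[k]) (Nat.prime_nth_prime k).ne_zero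
  have h1 : k < Nat.count Nat.Prime q :=
    (Nat.nth_strictMono Nat.infinite_setOf_prime).lt_iff_lt.1 (by rwa [Nat.nth_count hq])
  calc p[k + 1] ≤ p[Nat.count Nat.Prime q] := (Nat.nth_strictMono Nat.infinite_setOf_prime).monotone h1
    _ = q := Nat.nth_count hq
    _ ≤ 2 * p[k] := hle

/-! ### Profiles, mean and dither -/

/-- **Admissible profiles**: a real function `r` with `|r| ≤ 1 − δ` (`0 < δ < 1`) and a Lipschitz
constant `L`. In the application `r = (1 − δ) r_J` with `r_J` a Fejér mean of the square wave.
[cite: Montgomery1983, §2 (11)] -/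
structure Profile where
  /-- the real profile `r` -/
  r : ℝ → ℝ
  /-- the margin `δ`: `|r| ≤ 1 − δ` -/
  δ : ℝ
  /-- a Lipschitz constant of `r` -/
  L : ℝ
  δ_pos : 0 < δ
  δ_lt_one : δ < 1
  L_nonneg : 0 ≤ L
  abs_le : ∀ x, |r x| ≤ 1 - δ
  lipschitz : ∀ x y, |r x - r y| ≤ L * |x - y|

namespace Profile

variable (P : Profile)

/-- The mean `m(x) = i e^{ix} r(x)` (Montgomery's `b(ϑ) = i e^{iπϑ}` on `(0,1)`, here with `x = πϑ` and
damped by the profile `r`). [cite: Montgomery1983, §2 (11)] -/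
def mean (x : ℝ) : ℂ := I * exp (x * I) * (P.r x : ℂ)

/-- The amplitude `ρ(x) = √(1 − r(x)²) ∈ [√δ, 1]` of the dither. [folklore] -/
def amp (x : ℝ) : ℝ := Real.sqrt (1 - P.r x ^ 2)

/-- The dither direction `w(x) = −e^{ix} ρ(x)`. [folklore] -/
def dither (x : ℝ) : ℂ := -exp (x * I) * (P.amp x : ℂ)

/-- `r(x)² ≤ (1 − δ)²`. [folklore] -/
theorem r_sq_le (x : ℝ) : P.r x ^ 2 ≤ (1 - P.δ) ^ 2 := by
  have h := P.abs_le x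
  have h0 : 0 ≤ 1 - P.δ := by linarith [P.δ_lt_one]
  calc P.r x ^ 2 = |P.r x| ^ 2 := (sq_abs _).symm
    _ ≤ (1 - P.δ) ^ 2 := pow_le_pow_left₀ (abs_nonneg _) h 2

/-- `δ ≤ 1 − r(x)²` (indeed `δ(2 − δ) ≤ 1 − r²`). [folklore] -/
theorem delta_le_one_sub_sq (x : ℝ) : P.δ ≤ 1 - P.r x ^ 2 := by
  have := P.r_sq_le x
  nlinarith [P.δ_pos, P.δ_lt_one]

/-- `√δ ≤ ρ(x) ≤ 1`. [folklore] -/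
theorem sqrt_delta_le_amp (x : ℝ) : Real.sqrt P.δ ≤ P.amp x :=
  Real.sqrt_le_sqrt (P.delta_le_one_sub_sq x)

/-- `0 < ρ(x)`. [folklore] -/
theorem amp_pos (x : ℝ) : 0 < P.amp x :=
  (Real.sqrt_pos.2 P.δ_pos).trans_le (P.sqrt_delta_le_amp x)

/-- `ρ(x) ≤ 1`. [folklore] -/
theorem amp_le_one (x : ℝ) : P.amp x ≤ 1 := by
  unfold amp
  rw [Real.sqrt_le_one]
  nlinarith [sq_nonneg (P.r x)]

/-- `ρ(x)² = 1 − r(x)²`. [folklore] -/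
theorem amp_sq (x : ℝ) : P.amp x ^ 2 = 1 - P.r x ^ 2 :=
  Real.sq_sqrt (by linarith [P.delta_le_one_sub_sq x, P.δ_pos])

/-- **Unimodularity**: `‖m(x) + w(x)‖ = 1`. [folklore] -/
theorem norm_mean_add_dither (x : ℝ) : ‖P.mean x + P.dither x‖ = 1 := by
  have h : P.mean x + P.dither x = exp (x * I) * ((-P.amp x : ℝ) + (P.r x : ℝ) * I) := by
    unfold mean dither; push_cast; ring
  rw [h, norm_mul, norm_exp_ofReal_mul_I, one_mul, norm_add_mul_I, neg_sq, P.amp_sq]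
  simp

/-- **Unimodularity**: `‖m(x) − w(x)‖ = 1`. [folklore] -/
theorem norm_mean_sub_dither (x : ℝ) : ‖P.mean x - P.dither x‖ = 1 := by
  have h : P.mean x - P.dither x = exp (x * I) * ((P.amp x : ℝ) + (P.r x : ℝ) * I) := by
    unfold mean dither; ring
  rw [h, norm_mul, norm_exp_ofReal_mul_I, one_mul, norm_add_mul_I, P.amp_sq]
  simp

/-- `‖m(x)‖ ≤ 1` and `‖w(x)‖ ≤ 1`. [folklore] -/
theorem norm_mean_le (x : ℝ) : ‖P.mean x‖ ≤ 1 := by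
  unfold mean
  rw [norm_mul, norm_mul, norm_I, one_mul, norm_exp_ofReal_mul_I, one_mul, norm_real,
    Real.norm_eq_abs]
  linarith [P.abs_le x, P.δ_pos]

/-- `‖w(x)‖ ≤ 1`. [folklore] -/
theorem norm_dither_le (x : ℝ) : ‖P.dither x‖ ≤ 1 := by
  unfold dither
  rw [norm_mul, norm_neg, norm_exp_ofReal_mul_I, one_mul, norm_real, Real.norm_eq_abs,
    abs_of_pos (P.amp_pos x)]
  exact P.amp_le_one x

/-- `|√a − √b| ≤ |a − b|/(2m)` when `a, b ≥ m² > 0`. [folklore] -/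
theorem abs_sqrt_sub_sqrt_le {a b m : ℝ} (hm : 0 < m) (ha : m ^ 2 ≤ a) (hb : m ^ 2 ≤ b) :
    |Real.sqrt a - Real.sqrt b| ≤ |a - b| / (2 * m) := by
  have ha0 : 0 ≤ a := le_trans (sq_nonneg m) ha
  have hb0 : 0 ≤ b := le_trans (sq_nonneg m) hb
  have hsa : m ≤ Real.sqrt a := by
    rw [show m = Real.sqrt (m ^ 2) by rw [Real.sqrt_sq hm.le]]; exact Real.sqrt_le_sqrt ha
  have hsb : m ≤ Real.sqrt b := by
    rw [show m = Real.sqrt (m ^ 2) by rw [Real.sqrt_sq hm.le]]; exact Real.sqrt_le_sqrt hb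
  have hkey : (Real.sqrt a - Real.sqrt b) * (Real.sqrt a + Real.sqrt b) = a - b := by
    have := Real.mul_self_sqrt ha0
    have := Real.mul_self_sqrt hb0
    nlinarith
  have hsum : 2 * m ≤ Real.sqrt a + Real.sqrt b := by linarith
  rw [le_div_iff₀ (by linarith)]
  calc |Real.sqrt a - Real.sqrt b| * (2 * m) ≤ |Real.sqrt a - Real.sqrt b| * (Real.sqrt a + Real.sqrt b) :=
        mul_le_mul_of_nonneg_left hsum (abs_nonneg _)
    _ = |Real.sqrt a - Real.sqrt b| * |Real.sqrt a + Real.sqrt b| := by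
        rw [abs_of_pos (by linarith : 0 < Real.sqrt a + Real.sqrt b)]
    _ = |a - b| := by rw [← abs_mul, hkey]

/-- The amplitude is Lipschitz: `|ρ(x) − ρ(y)| ≤ (L/√δ) |x − y|`. [folklore] -/
theorem abs_amp_sub_amp_le (x y : ℝ) : |P.amp x - P.amp y| ≤ P.L / Real.sqrt P.δ * |x - y| := by
  have hm : 0 < Real.sqrt P.δ := Real.sqrt_pos.2 P.δ_pos
  have hsq : Real.sqrt P.δ ^ 2 = P.δ := Real.sq_sqrt P.δ_pos.le
  have h := abs_sqrt_sub_sqrt_le (a := 1 - P.r x ^ 2) (b := 1 - P.r y ^ 2) hm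
    (by rw [hsq]; exact P.delta_le_one_sub_sq x) (by rw [hsq]; exact P.delta_le_one_sub_sq y)
  unfold amp
  refine h.trans ?_
  have hdiff : |(1 - P.r x ^ 2) - (1 - P.r y ^ 2)| ≤ 2 * (P.L * |x - y|) := by
    rw [show (1 - P.r x ^ 2) - (1 - P.r y ^ 2) = (P.r y - P.r x) * (P.r y + P.r x) by ring, abs_mul]
    have h1 : |P.r y - P.r x| ≤ P.L * |x - y| := by
      have := P.lipschitz y x; rwa [abs_sub_comm y x] at this
    have h2 : |P.r y + P.r x| ≤ 2 := by
      have := P.abs_le x; have := P.abs_le y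
      have := abs_add_le (P.r y) (P.r x); linarith [P.δ_pos]
    calc |P.r y - P.r x| * |P.r y + P.r x| ≤ (P.L * |x - y|) * 2 :=
          mul_le_mul h1 h2 (abs_nonneg _) (mul_nonneg P.L_nonneg (abs_nonneg _))
      _ = 2 * (P.L * |x - y|) := by ring
  rw [div_le_iff₀ (by positivity)]
  calc |1 - P.r x ^ 2 - (1 - P.r y ^ 2)| ≤ 2 * (P.L * |x - y|) := hdiff
    _ = P.L / Real.sqrt P.δ * |x - y| * (2 * Real.sqrt P.δ) := by field_simp

/-- `‖e^{ix} − e^{iy}‖ ≤ |x − y|`. [folklore] -/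
theorem norm_exp_mul_I_sub_le (x y : ℝ) : ‖exp (x * I) - exp (y * I)‖ ≤ |x - y| := by
  have h : exp (x * I) - exp (y * I) = exp (y * I) * (exp (I * (x - y : ℝ)) - 1) := by
    rw [mul_sub, mul_one, ← exp_add]; push_cast; ring_nf
  rw [h, norm_mul, norm_exp_ofReal_mul_I, one_mul]
  simpa using (Real.norm_exp_I_mul_ofReal_sub_one_le (x := x - y))

/-- The Lipschitz constant `L_w = 1 + L/√δ` of the dither. [folklore] -/
def ditherLip : ℝ := 1 + P.L / Real.sqrt P.δ

/-- `0 < L_w`. [folklore] -/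
theorem ditherLip_pos : 0 < P.ditherLip := by
  unfold ditherLip; have := P.L_nonneg; positivity

/-- **The dither is Lipschitz**: `‖w(x) − w(y)‖ ≤ L_w |x − y|`. [folklore] -/
theorem norm_dither_sub_dither_le (x y : ℝ) :
    ‖P.dither x - P.dither y‖ ≤ P.ditherLip * |x - y| := by
  have h : P.dither x - P.dither y =
      -(exp (x * I) - exp (y * I)) * (P.amp x : ℂ) - exp (y * I) * ((P.amp x - P.amp y : ℝ) : ℂ) := by
    unfold dither; push_cast; ring
  rw [h]
  refine (norm_sub_le _ _).trans ?_
  rw [norm_mul, norm_neg, norm_mul, norm_exp_ofReal_mul_I, one_mul, norm_real, norm_real,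
    Real.norm_eq_abs, Real.norm_eq_abs, abs_of_pos (P.amp_pos x)]
  have h1 := norm_exp_mul_I_sub_le x y
  have h2 := P.abs_amp_sub_amp_le x y
  have h3 := P.amp_le_one x
  unfold ditherLip
  calc ‖exp (x * I) - exp (y * I)‖ * P.amp x + |P.amp x - P.amp y|
      ≤ |x - y| * 1 + P.L / Real.sqrt P.δ * |x - y| :=
        add_le_add (mul_le_mul h1 h3 (P.amp_pos x).le (abs_nonneg _)) h2
    _ = (1 + P.L / Real.sqrt P.δ) * |x - y| := by ring

end Profile

/-! ### The twist -/

/-- The phase point of a prime, `x_p = (log p)/2` (Montgomery's `ϑ = log p/2π`, `x = πϑ`).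
[cite: Montgomery1983, §2] -/
def phase (p : ℕ) : ℝ := Real.log p / 2

/-- The alternating sign `(−1)^{count p}` along the enumeration of the primes. [folklore] -/
def sign (p : ℕ) : ℝ := (-1) ^ Nat.count Nat.Prime p

/-- The sign at `p_k` is `(−1)^k`. [folklore] -/
theorem sign_nth_prime (k : ℕ) : sign (p[k]) = (-1) ^ k := by
  rw [sign, (Nat.count_nth_of_infinite Nat.infinite_setOf_prime)]

/-- The sign is `±1`. [folklore] -/
theorem sign_eq_or (p : ℕ) : sign p = 1 ∨ sign p = -1 := by
  unfold sign
  rcases Nat.even_or_odd (Nat.count Nat.Prime p) with h | h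
  · left; exact h.neg_one_pow
  · right; exact h.neg_one_pow

namespace Profile

variable (P : Profile)

/-- The value of the twist at a prime: `ψ(p) = m(x_p) ± w(x_p)` with the alternating sign.
[cite: Montgomery1983, §2] -/
def primeValue (p : ℕ) : ℂ := P.mean (phase p) + (sign p : ℂ) * P.dither (phase p)

/-- **Unimodular at the primes**: `‖ψ(p)‖ = 1` (for every `p`, prime or not). [folklore] -/
theorem norm_primeValue (p : ℕ) : ‖P.primeValue p‖ = 1 := by
  unfold primeValue
  rcases sign_eq_or p with h | h
  · rw [h, ofReal_one, one_mul]; exact P.norm_mean_add_dither _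
  · rw [h, ofReal_neg, ofReal_one, neg_one_mul, ← sub_eq_add_neg]; exact P.norm_mean_sub_dither _

/-- **The dithered twist** `ψ : ℕ →*₀ ℂ`, completely multiplicative with `ψ(p) = m(x_p) ± w(x_p)`
(`complMul` of `DavenportHeilbronnSeries.lean`). [cite: Montgomery1983, §2 (the totally multiplicative `a(n)`)] -/
def twist : ℕ →*₀ ℂ := complMul P.primeValue

/-- `ψ(p)` at a prime. [folklore] -/
theorem twist_prime {p : ℕ} (hp : p.Prime) : P.twist p = P.primeValue p := complMul_prime _ hp

/-- `‖ψ(p)‖ = 1` at primes. [folklore] -/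
theorem norm_twist_prime {p : ℕ} (hp : p.Prime) : ‖P.twist p‖ = 1 := by
  rw [P.twist_prime hp, P.norm_primeValue]

/-- `‖ψ(n)‖ ≤ 1` for all `n`. [folklore] -/
theorem norm_twist_le_one (n : ℕ) : ‖P.twist n‖ ≤ 1 :=
  norm_complMul_le_one (fun p _ ↦ (P.norm_primeValue p).le) n

/-- Complete multiplicativity in the form used by `Montgomery1983_theorem_of_twisted_zeros`. [folklore] -/
theorem twist_mul (m n : ℕ) : P.twist (m * n) = P.twist m * P.twist n := map_mul _ _ _

/-- Along the enumeration: `ψ(p_k) = m(x_k) + (−1)^k w(x_k)`. [folklore] -/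
theorem twist_nth_prime (k : ℕ) :
    P.twist (p[k]) = P.mean (phase (p[k])) + ((-1 : ℂ)) ^ k * P.dither (phase (p[k])) := by
  rw [P.twist_prime (Nat.prime_nth_prime k), primeValue, sign_nth_prime]
  push_cast; ring

/-! ### The alternating dither series, in pairs -/

/-- The phase point of `p_k`. [folklore] -/
def xk (k : ℕ) : ℝ := phase (p[k])

/-- `x_k = (log p_k)/2` is nondecreasing along the enumeration and `x_{k+1} − x_k ≤ (log 2)/2`,
indeed `2(x_{k+1} − x_k) = log p_{k+1} − log p_k ∈ [0, log 2]` (Bertrand). [folklore] -/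
theorem log_nth_prime_succ_sub (k : ℕ) :
    0 ≤ Real.log (p[k + 1]) - Real.log (p[k]) ∧
      Real.log (p[k + 1]) - Real.log (p[k]) ≤ Real.log 2 := by
  have h0 := nth_prime_pos_real k
  have hlt : (p[k] : ℝ) ≤ p[k + 1] := by
    exact_mod_cast ((Nat.nth_strictMono Nat.infinite_setOf_prime) (Nat.lt_succ_self k)).le
  have hle : (p[k + 1] : ℝ) ≤ 2 * p[k] := by exact_mod_cast nth_prime_succ_le_two_mul k
  constructor
  · linarith [Real.log_le_log h0 hlt]
  · have := Real.log_le_log (nth_prime_pos_real (k + 1)) hle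
    rw [Real.log_mul two_ne_zero h0.ne'] at this
    linarith

/-- `‖p^{−s}‖ = p^{−σ}` for the `k`-th prime. [folklore] -/
theorem norm_nth_prime_cpow_neg (k : ℕ) (s : ℂ) :
    ‖((p[k] : ℕ) : ℂ) ^ (-s)‖ = (p[k] : ℝ) ^ (-s.re) := by
  rw [norm_natCast_cpow_of_pos (Nat.prime_nth_prime k).pos, neg_re]

/-- `‖p^{−s} − q^{−s}‖ ≤ ‖s‖ (log q − log p) p^{−σ}` for `2 ≤ p ≤ q` and `σ ≥ 0` (mean value inequality
for `t ↦ e^{−st}` on `[log p, log q]`). [folklore] -/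
theorem norm_cpow_neg_sub_cpow_neg_le {p q : ℝ} (hp : 1 ≤ p) (hpq : p ≤ q) {s : ℂ} (hs : 0 ≤ s.re) :
    ‖(p : ℂ) ^ (-s) - (q : ℂ) ^ (-s)‖ ≤ ‖s‖ * (Real.log q - Real.log p) * p ^ (-s.re) := by
  have hp0 : 0 < p := one_pos.trans_le hp
  have hq0 : 0 < q := hp0.trans_le hpq
  -- `u ↦ exp(−s u)` on `[log p, log q]`
  set g : ℝ → ℂ := fun u ↦ exp (-s * u) with hg
  have hderiv : ∀ u ∈ Icc (Real.log p) (Real.log q), HasDerivWithinAt g (-s * exp (-s * u)) (Icc (Real.log p) (Real.log q)) u := by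
    intro u _
    have : HasDerivAt g (exp (-s * u) * (-s * 1)) u := by
      have h1 : HasDerivAt (fun u : ℝ ↦ -s * (u : ℂ)) (-s * 1) u :=
        (hasDerivAt_id (u : ℂ) |>.comp_ofReal).const_mul (-s) |>.congr_deriv (by simp)
      exact h1.cexp
    simpa [mul_comm] using this.hasDerivWithinAt
  have hbound : ∀ u ∈ Ico (Real.log p) (Real.log q), ‖-s * exp (-s * u)‖ ≤ ‖s‖ * p ^ (-s.re) := by
    intro u hu
    rw [norm_mul, norm_neg, norm_exp]
    refine mul_le_mul_of_nonneg_left ?_ (norm_nonneg _)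
    have hre : (-s * (u : ℂ)).re = -(s.re * u) := by simp
    rw [hre, Real.rpow_def_of_pos hp0]
    apply Real.exp_le_exp.2
    have : Real.log p ≤ u := hu.1
    nlinarith
  have h := norm_image_sub_le_of_norm_deriv_le_segment' hderiv hbound (Real.log q)
    (right_mem_Icc.2 (Real.log_le_log hp0 hpq))
  have hgp : g (Real.log p) = (p : ℂ) ^ (-s) := by
    rw [hg]; simp only
    rw [cpow_def_of_ne_zero (by exact_mod_cast hp0.ne'), ← ofReal_log hp0.le]; ring_nf
  have hgq : g (Real.log q) = (q : ℂ) ^ (-s) := by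
    rw [hg]; simp only
    rw [cpow_def_of_ne_zero (by exact_mod_cast hq0.ne'), ← ofReal_log hq0.le]; ring_nf
  rw [hgp, hgq] at h
  rw [norm_sub_rev]
  calc ‖(q : ℂ) ^ (-s) - (p : ℂ) ^ (-s)‖ ≤ ‖s‖ * p ^ (-s.re) * (Real.log q - Real.log p) := h
    _ = ‖s‖ * (Real.log q - Real.log p) * p ^ (-s.re) := by ring

/-- **Convexity**: `Δ e^{−v} ≤ (1 − e^{−v})`-type bound: for `0 < σ`, `0 ≤ Δ ≤ log 2` and `P > 0`,
`Δ · P^{−σ} ≤ (2^σ/σ) (P^{−σ} − (P e^{Δ})^{−σ})`, the telescoping-friendly form of the pair weights.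
[folklore] -/
theorem mul_rpow_neg_le_div_mul_sub {σ Δ Pp : ℝ} (hσ : 0 < σ) (hΔ0 : 0 ≤ Δ) (hΔ : Δ ≤ Real.log 2)
    (hP : 0 < Pp) :
    Δ * Pp ^ (-σ) ≤ (2 : ℝ) ^ σ / σ * (Pp ^ (-σ) - (Pp * Real.exp Δ) ^ (-σ)) := by
  -- `(P e^Δ)^{−σ} = P^{−σ} e^{−σΔ}` and `1 − e^{−v} ≥ v e^{−v} ≥ v 2^{−σ}` for `v = σΔ ≤ σ log 2`
  have h1 : (Pp * Real.exp Δ) ^ (-σ) = Pp ^ (-σ) * Real.exp (-(σ * Δ)) := by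
    rw [Real.mul_rpow hP.le (Real.exp_pos _).le, ← Real.exp_mul]; ring_nf
  rw [h1]
  have hv : σ * Δ * Real.exp (-(σ * Δ)) ≤ 1 - Real.exp (-(σ * Δ)) := by
    -- from `1 + v ≤ e^{v}`, `v = σΔ ≥ 0`
    have h := Real.add_one_le_exp (σ * Δ)
    have he : Real.exp (-(σ * Δ)) * Real.exp (σ * Δ) = 1 := by rw [← Real.exp_add]; simp
    have hpos := Real.exp_pos (-(σ * Δ))
    nlinarith [mul_le_mul_of_nonneg_left h hpos.le]
  have h2 : (2 : ℝ) ^ (-σ) ≤ Real.exp (-(σ * Δ)) := by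
    rw [Real.rpow_def_of_pos two_pos]
    exact Real.exp_le_exp.2 (by nlinarith)
  have hPσ : 0 < Pp ^ (-σ) := Real.rpow_pos_of_pos hP _
  have h2σ : (0 : ℝ) < 2 ^ σ := Real.rpow_pos_of_pos two_pos _
  have h22 : (2 : ℝ) ^ σ * (2 : ℝ) ^ (-σ) = 1 := by
    rw [← Real.rpow_add two_pos]; simp
  -- `Δ ≤ (2^σ/σ)(1 − e^{−σΔ})`
  have key : Δ ≤ (2 : ℝ) ^ σ / σ * (1 - Real.exp (-(σ * Δ))) := by
    rw [div_mul_eq_mul_div, le_div_iff₀ hσ]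
    calc Δ * σ = (2 : ℝ) ^ σ * (σ * Δ * (2 : ℝ) ^ (-σ)) := by
          rw [show (2 : ℝ) ^ σ * (σ * Δ * (2 : ℝ) ^ (-σ)) = ((2 : ℝ) ^ σ * (2 : ℝ) ^ (-σ)) * (σ * Δ) by ring,
            h22]; ring
      _ ≤ (2 : ℝ) ^ σ * (σ * Δ * Real.exp (-(σ * Δ))) := by
          refine mul_le_mul_of_nonneg_left ?_ h2σ.le
          exact mul_le_mul_of_nonneg_left h2 (by positivity)
      _ ≤ (2 : ℝ) ^ σ * (1 - Real.exp (-(σ * Δ))) := mul_le_mul_of_nonneg_left hv h2σ.le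
  calc Δ * Pp ^ (-σ) ≤ ((2 : ℝ) ^ σ / σ * (1 - Real.exp (-(σ * Δ)))) * Pp ^ (-σ) :=
        mul_le_mul_of_nonneg_right key hPσ.le
    _ = (2 : ℝ) ^ σ / σ * (Pp ^ (-σ) - Pp ^ (-σ) * Real.exp (-(σ * Δ))) := by ring

/-- The **pair terms** `a_j(s) = w(x_{2j}) p_{2j}^{−s} − w(x_{2j+1}) p_{2j+1}^{−s}` of the dither series.
[folklore] -/
def pairTerm (s : ℂ) (j : ℕ) : ℂ :=
  P.dither (xk (2 * j)) * ((p[2 * j] : ℕ) : ℂ) ^ (-s) -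
    P.dither (xk (2 * j + 1)) * ((p[2 * j + 1] : ℕ) : ℂ) ^ (-s)

/-- The weights `d_j(σ) = p_{2j}^{−σ} − p_{2j+1}^{−σ} ≥ 0`. [folklore] -/
def pairWeight (σ : ℝ) (j : ℕ) : ℝ := (p[2 * j] : ℝ) ^ (-σ) - (p[2 * j + 1] : ℝ) ^ (-σ)

/-- `d_j(σ) ≥ 0` for `σ ≥ 0`. [folklore] -/
theorem pairWeight_nonneg {σ : ℝ} (hσ : 0 ≤ σ) (j : ℕ) : 0 ≤ pairWeight σ j := by
  unfold pairWeight
  have h := ((Nat.nth_strictMono Nat.infinite_setOf_prime) (Nat.lt_succ_self (2 * j))).le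
  have h' : (p[2 * j] : ℝ) ≤ p[2 * j + 1] := by exact_mod_cast h
  have := Real.rpow_le_rpow_of_nonpos (nth_prime_pos_real _) h' (by linarith : -σ ≤ 0)
  linarith

/-- **Telescoping**: `Σ_{j<J} d_{j₀+j}(σ) ≤ p_{2j₀}^{−σ}`. [folklore] -/
theorem sum_pairWeight_le {σ : ℝ} (hσ : 0 ≤ σ) (j₀ J : ℕ) :
    ∑ j ∈ Finset.range J, pairWeight σ (j₀ + j) ≤ (p[2 * j₀] : ℝ) ^ (-σ) := by
  -- compare with the telescoping sum of `f(j) = p_{2(j₀+j)}^{−σ}`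
  set f : ℕ → ℝ := fun j ↦ (p[2 * (j₀ + j)] : ℝ) ^ (-σ) with hf
  have hmono : ∀ {a b : ℕ}, a ≤ b → (p[b] : ℝ) ^ (-σ) ≤ (p[a] : ℝ) ^ (-σ) := by
    intro a b hab
    have h' : (p[a] : ℝ) ≤ p[b] := by exact_mod_cast (Nat.nth_strictMono Nat.infinite_setOf_prime).monotone hab
    exact Real.rpow_le_rpow_of_nonpos (nth_prime_pos_real _) h' (by linarith)
  have hle : ∀ j, pairWeight σ (j₀ + j) ≤ f j - f (j + 1) := by
    intro j
    simp only [hf, pairWeight]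
    have : (p[2 * (j₀ + (j + 1))] : ℝ) ^ (-σ) ≤ (p[2 * (j₀ + j) + 1] : ℝ) ^ (-σ) :=
      hmono (by omega)
    rw [show 2 * (j₀ + j) = 2 * (j₀ + j) by rfl]
    linarith
  calc ∑ j ∈ Finset.range J, pairWeight σ (j₀ + j) ≤ ∑ j ∈ Finset.range J, (f j - f (j + 1)) :=
        Finset.sum_le_sum fun j _ ↦ hle j
    _ = f 0 - f J := Finset.sum_range_sub' f J
    _ ≤ f 0 := by linarith [Real.rpow_nonneg (nth_prime_pos_real (2 * (j₀ + J))).le (-σ)]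
    _ = (p[2 * j₀] : ℝ) ^ (-σ) := by simp [hf]

/-- **The pair bound**: for `0 < σ₁ ≤ Re s`,
`‖a_j(s)‖ ≤ (‖s‖ + L_w) (2^{σ₁}/σ₁) d_j(σ₁)`. [folklore] -/
theorem norm_pairTerm_le {s : ℂ} {σ₁ : ℝ} (hσ₁ : 0 < σ₁) (hs : σ₁ ≤ s.re) (j : ℕ) :
    ‖P.pairTerm s j‖ ≤ (‖s‖ + P.ditherLip) * ((2 : ℝ) ^ σ₁ / σ₁) * pairWeight σ₁ j := by
  set pp : ℝ := (p[2 * j] : ℝ) with hp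
  set qq : ℝ := (p[2 * j + 1] : ℝ) with hq
  have hp0 : 0 < pp := nth_prime_pos_real _
  have hp1 : 1 ≤ pp := by have := two_le_nth_prime_real (2 * j); rw [hp]; linarith
  have hpq : pp ≤ qq := by rw [hp, hq]; exact_mod_cast ((Nat.nth_strictMono Nat.infinite_setOf_prime) (Nat.lt_succ_self _)).le
  obtain ⟨hΔ0, hΔ⟩ := log_nth_prime_succ_sub (2 * j)
  set Δ : ℝ := Real.log qq - Real.log pp with hΔdef
  have hqexp : qq = pp * Real.exp Δ := by
    rw [hΔdef, Real.exp_sub, Real.exp_log (hp0.trans_le hpq |> fun h ↦ hp0.trans_le hpq),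
      Real.exp_log hp0]
    field_simp
  -- decomposition `a_j = w_p (pp^{-s} − qq^{-s}) + (w_p − w_q) qq^{-s}`
  have hdec : P.pairTerm s j = P.dither (xk (2 * j)) * ((pp : ℂ) ^ (-s) - (qq : ℂ) ^ (-s)) +
      (P.dither (xk (2 * j)) - P.dither (xk (2 * j + 1))) * (qq : ℂ) ^ (-s) := by
    simp only [pairTerm, hp, hq]; push_cast; ring
  rw [hdec]
  have hσ0 : 0 ≤ s.re := hσ₁.le.trans hs
  -- `pp^{−σ} ≤ pp^{−σ₁}` since `pp ≥ 1`
  have hpσ : pp ^ (-s.re) ≤ pp ^ (-σ₁) := Real.rpow_le_rpow_of_exponent_le hp1 (by linarith)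
  -- the two pieces
  have h1 : ‖P.dither (xk (2 * j)) * ((pp : ℂ) ^ (-s) - (qq : ℂ) ^ (-s))‖ ≤ ‖s‖ * Δ * pp ^ (-σ₁) := by
    rw [norm_mul]
    calc ‖P.dither (xk (2 * j))‖ * ‖(pp : ℂ) ^ (-s) - (qq : ℂ) ^ (-s)‖ ≤ 1 * (‖s‖ * Δ * pp ^ (-s.re)) :=
          mul_le_mul (P.norm_dither_le _) (norm_cpow_neg_sub_cpow_neg_le hp1 hpq hσ0) (norm_nonneg _)
            zero_le_one
      _ = ‖s‖ * Δ * pp ^ (-s.re) := one_mul _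
      _ ≤ ‖s‖ * Δ * pp ^ (-σ₁) := mul_le_mul_of_nonneg_left hpσ (by positivity)
  have h2 : ‖(P.dither (xk (2 * j)) - P.dither (xk (2 * j + 1))) * (qq : ℂ) ^ (-s)‖ ≤
      P.ditherLip * Δ * pp ^ (-σ₁) := by
    rw [norm_mul]
    have hw := P.norm_dither_sub_dither_le (xk (2 * j)) (xk (2 * j + 1))
    have hx : |xk (2 * j) - xk (2 * j + 1)| = Δ / 2 := by
      simp only [xk, phase, hΔdef, hp, hq]
      rw [abs_sub_comm, abs_of_nonneg (by linarith)]; ring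
    rw [hx] at hw
    have hqn : ‖(qq : ℂ) ^ (-s)‖ ≤ pp ^ (-σ₁) := by
      have hq0 : 0 < qq := hp0.trans_le hpq
      rw [Complex.norm_cpow_eq_rpow_re_of_pos hq0, neg_re]
      exact (Real.rpow_le_rpow_of_nonpos hp0 hpq (by linarith)).trans hpσ
    have hL := P.ditherLip_pos
    calc ‖P.dither (xk (2 * j)) - P.dither (xk (2 * j + 1))‖ * ‖(qq : ℂ) ^ (-s)‖
        ≤ (P.ditherLip * (Δ / 2)) * pp ^ (-σ₁) :=
          mul_le_mul hw hqn (norm_nonneg _) (by positivity)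
      _ ≤ P.ditherLip * Δ * pp ^ (-σ₁) := by
          have : 0 ≤ P.ditherLip * Δ * pp ^ (-σ₁) := by positivity
          nlinarith
  -- combine with the convexity bound at `σ₁`
  have hkey := mul_rpow_neg_le_div_mul_sub hσ₁ hΔ0 hΔ hp0
  rw [← hqexp] at hkey
  have hw' : pairWeight σ₁ j = pp ^ (-σ₁) - qq ^ (-σ₁) := by simp [pairWeight, hp, hq]
  rw [hw']
  have hL := P.ditherLip_pos
  calc ‖_ + _‖ ≤ ‖s‖ * Δ * pp ^ (-σ₁) + P.ditherLip * Δ * pp ^ (-σ₁) := norm_add_le_of_le h1 h2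
    _ = (‖s‖ + P.ditherLip) * (Δ * pp ^ (-σ₁)) := by ring
    _ ≤ (‖s‖ + P.ditherLip) * ((2 : ℝ) ^ σ₁ / σ₁ * (pp ^ (-σ₁) - qq ^ (-σ₁))) :=
        mul_le_mul_of_nonneg_left hkey (by positivity)
    _ = _ := by ring

/-- The weights are summable: `Σ_j d_{j₀+j}(σ) ≤ p_{2j₀}^{−σ}`. [folklore] -/
theorem summable_pairWeight {σ : ℝ} (hσ : 0 ≤ σ) (j₀ : ℕ) : Summable fun j ↦ pairWeight σ (j₀ + j) :=
  summable_of_sum_range_le (fun _ ↦ pairWeight_nonneg hσ _) (sum_pairWeight_le hσ j₀)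

/-- `Σ_j d_{j₀+j}(σ) ≤ p_{2j₀}^{−σ}` as a `tsum`. [folklore] -/
theorem tsum_pairWeight_le {σ : ℝ} (hσ : 0 ≤ σ) (j₀ : ℕ) :
    ∑' j, pairWeight σ (j₀ + j) ≤ (p[2 * j₀] : ℝ) ^ (-σ) :=
  Real.tsum_le_of_sum_range_le (fun _ ↦ pairWeight_nonneg hσ _) (sum_pairWeight_le hσ j₀)

/-- **The dither series** `A(s) = Σ_j a_j(s)` (the alternating prime series `Σ_k (−1)^k w(x_k) p_k^{−s}`
grouped in consecutive pairs). [folklore] -/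
def ditherSeries (s : ℂ) : ℂ := ∑' j, P.pairTerm s j

/-- Summability of the pairs for `Re s > 0`, with the tail bound
`Σ_j ‖a_{j₀+j}(s)‖ ≤ (‖s‖ + L_w)(2^{σ₁}/σ₁) p_{2j₀}^{−σ₁}` (`0 < σ₁ ≤ Re s`). [folklore] -/
theorem summable_norm_pairTerm {s : ℂ} {σ₁ : ℝ} (hσ₁ : 0 < σ₁) (hs : σ₁ ≤ s.re) (j₀ : ℕ) :
    (Summable fun j ↦ ‖P.pairTerm s (j₀ + j)‖) ∧
      ∑' j, ‖P.pairTerm s (j₀ + j)‖ ≤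
        (‖s‖ + P.ditherLip) * ((2 : ℝ) ^ σ₁ / σ₁) * (p[2 * j₀] : ℝ) ^ (-σ₁) := by
  have hL := P.ditherLip_pos
  have hC : 0 ≤ (‖s‖ + P.ditherLip) * ((2 : ℝ) ^ σ₁ / σ₁) := by positivity
  have hbd : ∀ j, ‖P.pairTerm s (j₀ + j)‖ ≤ (‖s‖ + P.ditherLip) * ((2 : ℝ) ^ σ₁ / σ₁) * pairWeight σ₁ (j₀ + j) :=
    fun j ↦ P.norm_pairTerm_le hσ₁ hs _
  have hsw := (summable_pairWeight hσ₁.le j₀).mul_left ((‖s‖ + P.ditherLip) * ((2 : ℝ) ^ σ₁ / σ₁))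
  have hsum : Summable fun j ↦ ‖P.pairTerm s (j₀ + j)‖ :=
    Summable.of_nonneg_of_le (fun j ↦ norm_nonneg _) hbd hsw
  refine ⟨hsum, ?_⟩
  calc ∑' j, ‖P.pairTerm s (j₀ + j)‖
      ≤ ∑' j, (‖s‖ + P.ditherLip) * ((2 : ℝ) ^ σ₁ / σ₁) * pairWeight σ₁ (j₀ + j) :=
        hsum.tsum_le_tsum hbd hsw
    _ = (‖s‖ + P.ditherLip) * ((2 : ℝ) ^ σ₁ / σ₁) * ∑' j, pairWeight σ₁ (j₀ + j) := tsum_mul_left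
    _ ≤ (‖s‖ + P.ditherLip) * ((2 : ℝ) ^ σ₁ / σ₁) * (p[2 * j₀] : ℝ) ^ (-σ₁) :=
        mul_le_mul_of_nonneg_left (tsum_pairWeight_le hσ₁.le j₀) hC

/-- The pairs are summable for `Re s > 0`. [folklore] -/
theorem summable_pairTerm {s : ℂ} (hs : 0 < s.re) : Summable (P.pairTerm s) := by
  have h := (P.summable_norm_pairTerm hs le_rfl 0).1
  simp only [zero_add] at h
  exact h.of_norm

/-- Each pair term is an entire function of `s`. [folklore] -/
theorem differentiable_pairTerm (j : ℕ) : Differentiable ℂ fun s ↦ P.pairTerm s j := by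
  unfold pairTerm
  have h : ∀ k : ℕ, Differentiable ℂ fun s : ℂ ↦ ((p[k] : ℕ) : ℂ) ^ (-s) := fun k ↦
    (differentiable_id.neg).const_cpow (Or.inl (by exact_mod_cast (Nat.prime_nth_prime k).ne_zero))
  exact ((h _).const_mul _).sub ((h _).const_mul _)

/-- **The dither series is holomorphic on `Re s > 0`** (locally uniform convergence of the pairs).
[folklore] -/
theorem differentiableOn_ditherSeries : DifferentiableOn ℂ P.ditherSeries {s : ℂ | 0 < s.re} := by
  intro s₀ hs₀
  have hs₀ : 0 < s₀.re := hs₀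
  set σ₁ : ℝ := s₀.re / 2 with hσ₁
  have hσ₁0 : 0 < σ₁ := by rw [hσ₁]; linarith
  set R : ℝ := ‖s₀‖ + 1 with hR
  set U : Set ℂ := {s : ℂ | σ₁ < s.re} ∩ Metric.ball 0 R with hU
  have hUo : IsOpen U := (isOpen_lt continuous_const continuous_re).inter Metric.isOpen_ball
  have hs₀U : s₀ ∈ U := ⟨by show σ₁ < s₀.re; rw [hσ₁]; linarith, by simp [hR]⟩
  have hL := P.ditherLip_pos
  -- uniform summable bound on `U`
  set u : ℕ → ℝ := fun j ↦ (R + P.ditherLip) * ((2 : ℝ) ^ σ₁ / σ₁) * pairWeight σ₁ j with hu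
  have hu_sum : Summable u := by
    have := (summable_pairWeight hσ₁0.le 0).mul_left ((R + P.ditherLip) * ((2 : ℝ) ^ σ₁ / σ₁))
    simpa [hu] using this
  have hbound : ∀ j s, s ∈ U → ‖P.pairTerm s j‖ ≤ u j := by
    intro j s hs
    have hsre : σ₁ ≤ s.re := le_of_lt hs.1
    have hsn : ‖s‖ ≤ R := by
      have := hs.2; rw [Metric.mem_ball, dist_zero_right] at this; exact this.le
    refine (P.norm_pairTerm_le hσ₁0 hsre j).trans ?_
    have hw := pairWeight_nonneg hσ₁0.le j
    have h2 : 0 ≤ (2 : ℝ) ^ σ₁ / σ₁ := by positivity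
    exact mul_le_mul_of_nonneg_right (mul_le_mul_of_nonneg_right (by linarith) h2) hw
  have hdiff : DifferentiableOn ℂ (fun s ↦ ∑' j, P.pairTerm s j) U :=
    differentiableOn_tsum_of_summable_norm hu_sum
      (fun j ↦ (P.differentiable_pairTerm j).differentiableOn) hUo hbound
  have : DifferentiableAt ℂ P.ditherSeries s₀ := by
    have h := hdiff.differentiableAt (hUo.mem_nhds hs₀U)
    exact h
  exact this.differentiableWithinAt

/-! ### The bound in the strip `1 − 1/log(|t|+3) ≤ σ ≤ 2` -/

/-- `Σ_{k < 2n} f(k) = Σ_{j<n} (f(2j) + f(2j+1))`. [folklore] -/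
private theorem sum_range_two_mul {M : Type*} [AddCommMonoid M] (f : ℕ → M) (n : ℕ) :
    ∑ k ∈ Finset.range (2 * n), f k = ∑ j ∈ Finset.range n, (f (2 * j) + f (2 * j + 1)) := by
  induction n with
  | zero => simp
  | succ n ih =>
    rw [Finset.sum_range_succ, ← ih, show 2 * (n + 1) = 2 * n + 1 + 1 by ring,
      Finset.sum_range_succ, Finset.sum_range_succ, add_assoc]

/-- A crude bound on `e`: `exp 1 < 3`. [folklore] -/
private theorem exp_one_lt_three : Real.exp 1 < 3 := lt_trans Real.exp_one_lt_d9 (by norm_num)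

/-- `1 ≤ log y` for `y ≥ 3`. [folklore] -/
private theorem one_le_log_of_three_le {y : ℝ} (hy : 3 ≤ y) : 1 ≤ Real.log y := by
  rw [Real.le_log_iff_exp_le (by linarith)]
  linarith [exp_one_lt_three]

/-- In the strip: `y^{1−σ} ≤ e` for `y ≥ 3` and `1 − 1/log y ≤ σ`. [folklore] -/
theorem rpow_one_sub_le_exp_one {y σ : ℝ} (hy : 3 ≤ y) (hσ : 1 - 1 / Real.log y ≤ σ) :
    y ^ (1 - σ) ≤ Real.exp 1 := by
  have hlog := one_le_log_of_three_le hy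
  rw [Real.rpow_def_of_pos (by linarith)]
  apply Real.exp_le_exp.2
  rcases le_or_gt 1 σ with h | h
  · calc Real.log y * (1 - σ) ≤ 0 := mul_nonpos_of_nonneg_of_nonpos (by linarith) (by linarith)
      _ ≤ 1 := zero_le_one
  · have h1 : 1 - σ ≤ 1 / Real.log y := by linarith
    calc Real.log y * (1 - σ) ≤ Real.log y * (1 / Real.log y) :=
          mul_le_mul_of_nonneg_left h1 (by linarith)
      _ = 1 := by field_simp

/-- For a prime (or any real) `1 ≤ p ≤ 2y` in the strip: `p^{−σ} ≤ 6/p`. [folklore] -/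
theorem rpow_neg_le_six_div {p y σ : ℝ} (hp : 1 ≤ p) (hpy : p ≤ 2 * y) (hy : 3 ≤ y)
    (hσ : 1 - 1 / Real.log y ≤ σ) : p ^ (-σ) ≤ 6 / p := by
  have hp0 : 0 < p := by linarith
  have hlog := one_le_log_of_three_le hy
  -- `p^{−σ} = p^{1−σ}/p` and `p^{1−σ} ≤ (2y)^{1−σ} ≤ 2 e`
  have hσ0 : 0 ≤ σ := by
    have : 1 / Real.log y ≤ 1 := by rw [div_le_one (by linarith)]; exact hlog
    linarith
  have hsplit : p ^ (-σ) = p ^ (1 - σ) / p := by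
    rw [Real.rpow_sub hp0, Real.rpow_one, Real.rpow_neg hp0.le]
    field_simp
  have hmain : p ^ (1 - σ) ≤ 6 := by
    rcases le_or_gt 1 σ with h | h
    · calc p ^ (1 - σ) ≤ p ^ (0 : ℝ) := Real.rpow_le_rpow_of_exponent_le hp (by linarith)
        _ = 1 := Real.rpow_zero _
        _ ≤ 6 := by norm_num
    · have h1 : p ^ (1 - σ) ≤ (2 * y) ^ (1 - σ) := Real.rpow_le_rpow hp0.le hpy (by linarith)
      have h2 : (2 * y) ^ (1 - σ) = (2 : ℝ) ^ (1 - σ) * y ^ (1 - σ) :=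
        Real.mul_rpow (by norm_num) (by linarith)
      have h3 : (2 : ℝ) ^ (1 - σ) ≤ 2 := by
        calc (2 : ℝ) ^ (1 - σ) ≤ (2 : ℝ) ^ (1 : ℝ) :=
              Real.rpow_le_rpow_of_exponent_le (by norm_num) (by linarith)
          _ = 2 := Real.rpow_one _
      have h4 := rpow_one_sub_le_exp_one hy hσ
      calc p ^ (1 - σ) ≤ (2 : ℝ) ^ (1 - σ) * y ^ (1 - σ) := by rw [← h2]; exact h1
        _ ≤ 2 * Real.exp 1 := mul_le_mul h3 h4 (Real.rpow_nonneg (by linarith) _) (by norm_num)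
        _ ≤ 6 := by linarith [exp_one_lt_three]
  rw [hsplit]
  exact div_le_div_of_nonneg_right hmain hp0.le

/-- Existence of pairs beyond any level: there is `j` with `y < p_{2j}`. [folklore] -/
theorem exists_lt_nth_prime_two_mul (y : ℝ) : ∃ j : ℕ, y < p[2 * j] := by
  obtain ⟨n, hn⟩ := exists_nat_gt y
  refine ⟨n, hn.trans_le ?_⟩
  have := Nat.add_two_le_nth_prime (2 * n)
  exact_mod_cast (show n ≤ p[2 * n] by omega)

/-- **The dither series in the strip**: for `1/2 ≤ σ ≤ 2` and `1 − 1/log(|t| + 3) ≤ σ`,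
`‖A(s)‖ ≤ 6 log log(2|t| + 6) + 24 + 22 (1 + L_w)`, i.e. `exp A(s)` grows at most like
`(log(2|t|+6))^6`. (Head `p ≤ 2(|t|+3)`: trivially, `p^{−σ} ≤ 6/p` and Mertens'
`Σ_{p ≤ x} 1/p ≤ log log x + 4`; tail: the pair bound and telescoping.)
[cite: HardyWright2008, Thm. 427] -/
theorem norm_ditherSeries_le {s : ℂ} (hσhalf : 1 / 2 ≤ s.re) (hσ2 : s.re ≤ 2)
    (hσt : 1 - 1 / Real.log (|s.im| + 3) ≤ s.re) :
    ‖P.ditherSeries s‖ ≤ 6 * Real.log (Real.log (2 * |s.im| + 6)) + 24 + 22 * (1 + P.ditherLip) := by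
  set σ : ℝ := s.re with hσdef
  set y : ℝ := |s.im| + 3 with hy
  have hy3 : 3 ≤ y := by rw [hy]; linarith [abs_nonneg s.im]
  have hy1 : 1 ≤ y := by linarith
  have hσ0 : 0 < σ := by linarith
  have hL := P.ditherLip_pos
  -- choose the first pair beyond `y`
  classical
  obtain ⟨j₀, hj₀, hmin⟩ : ∃ j₀ : ℕ, y < p[2 * j₀] ∧ ∀ j < j₀, (p[2 * j] : ℝ) ≤ y := by
    refine ⟨Nat.find (exists_lt_nth_prime_two_mul y), Nat.find_spec (exists_lt_nth_prime_two_mul y),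
      fun j hj ↦ ?_⟩
    have := Nat.find_min (exists_lt_nth_prime_two_mul y) hj
    exact not_lt.1 this
  -- split the series
  have hsum := P.summable_pairTerm (s := s) hσ0
  have hsplit := (hsum.sum_add_tsum_nat_add j₀).symm
  -- (1) the tail
  obtain ⟨htail_sum, htail⟩ := P.summable_norm_pairTerm hσ0 le_rfl j₀
  have htail' : ‖∑' j, P.pairTerm s (j + j₀)‖ ≤ 22 * (1 + P.ditherLip) := by
    have e : (fun j ↦ P.pairTerm s (j + j₀)) = fun j ↦ P.pairTerm s (j₀ + j) := by
      funext j; rw [add_comm]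
    rw [e]
    refine (norm_tsum_le_tsum_norm htail_sum).trans (htail.trans ?_)
    -- `(‖s‖ + L_w)(2^σ/σ) p_{2j₀}^{−σ} ≤ (y + L_w) · 8 · y^{−σ} ≤ 8 e (1 + L_w)`
    have hs_le : ‖s‖ ≤ y := by
      have h1 := norm_le_abs_re_add_abs_im s
      have h2 : |s.re| ≤ 2 := by rw [_root_.abs_le]; constructor <;> linarith
      rw [hy]; linarith
    have h2σ : (2 : ℝ) ^ σ / σ ≤ 8 := by
      rw [div_le_iff₀ hσ0]
      have h4 : (2 : ℝ) ^ σ ≤ 4 := by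
        calc (2 : ℝ) ^ σ ≤ (2 : ℝ) ^ (2 : ℝ) := Real.rpow_le_rpow_of_exponent_le (by norm_num) hσ2
          _ = 4 := by rw [Real.rpow_two]; norm_num
      linarith
    have hp : (p[2 * j₀] : ℝ) ^ (-σ) ≤ y ^ (-σ) :=
      Real.rpow_le_rpow_of_nonpos (by linarith) hj₀.le (by linarith)
    have hyσ : y * y ^ (-σ) = y ^ (1 - σ) := by
      rw [Real.rpow_sub (by linarith), Real.rpow_one, Real.rpow_neg (by linarith), div_eq_mul_inv]
    have hye := rpow_one_sub_le_exp_one (σ := σ) hy3 hσt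
    calc (‖s‖ + P.ditherLip) * ((2 : ℝ) ^ σ / σ) * (p[2 * j₀] : ℝ) ^ (-σ)
        ≤ ((1 + P.ditherLip) * y) * 8 * y ^ (-σ) := by
          have h0 : 0 ≤ (p[2 * j₀] : ℝ) ^ (-σ) := Real.rpow_nonneg (nth_prime_pos_real _).le _
          have ha : ‖s‖ + P.ditherLip ≤ (1 + P.ditherLip) * y := by nlinarith
          have hb : 0 ≤ (2 : ℝ) ^ σ / σ := by positivity
          calc (‖s‖ + P.ditherLip) * ((2 : ℝ) ^ σ / σ) * (p[2 * j₀] : ℝ) ^ (-σ)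
              ≤ ((1 + P.ditherLip) * y) * 8 * (p[2 * j₀] : ℝ) ^ (-σ) :=
                mul_le_mul_of_nonneg_right (mul_le_mul ha h2σ hb (by positivity)) h0
            _ ≤ ((1 + P.ditherLip) * y) * 8 * y ^ (-σ) :=
                mul_le_mul_of_nonneg_left hp (by positivity)
      _ = 8 * (1 + P.ditherLip) * (y * y ^ (-σ)) := by ring
      _ ≤ 8 * (1 + P.ditherLip) * Real.exp 1 := by
          rw [hyσ]; exact mul_le_mul_of_nonneg_left hye (by positivity)
      _ ≤ 8 * (1 + P.ditherLip) * 2.72 :=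
          mul_le_mul_of_nonneg_left (le_of_lt (lt_trans Real.exp_one_lt_d9 (by norm_num))) (by positivity)
      _ ≤ 22 * (1 + P.ditherLip) := by linarith
  -- (2) the head: primes `p_k`, `k < 2j₀`, all `≤ 2y`
  have hhead_primes : ∀ k < 2 * j₀, (p[k] : ℝ) ≤ 2 * y := by
    intro k hk
    have hj₀pos : 0 < j₀ := by omega
    have h1 : (p[2 * (j₀ - 1)] : ℝ) ≤ y := hmin (j₀ - 1) (by omega)
    have h2 : p[k] ≤ p[2 * (j₀ - 1) + 1] := (Nat.nth_strictMono Nat.infinite_setOf_prime).monotone (by omega)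
    have h3 := nth_prime_succ_le_two_mul (2 * (j₀ - 1))
    have h2' : (p[k] : ℝ) ≤ p[2 * (j₀ - 1) + 1] := by exact_mod_cast h2
    have h3' : (p[2 * (j₀ - 1) + 1] : ℝ) ≤ 2 * p[2 * (j₀ - 1)] := by exact_mod_cast h3
    linarith
  have hhead : ‖∑ j ∈ Finset.range j₀, P.pairTerm s j‖ ≤ 6 * Real.log (Real.log (2 * |s.im| + 6)) + 24 := by
    -- `‖Σ_{j<j₀} a_j‖ ≤ Σ_{k<2j₀} p_k^{−σ}`
    have h1 : ‖∑ j ∈ Finset.range j₀, P.pairTerm s j‖ ≤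
        ∑ k ∈ Finset.range (2 * j₀), (p[k] : ℝ) ^ (-σ) := by
      rw [sum_range_two_mul (fun k ↦ (p[k] : ℝ) ^ (-σ)) j₀]
      refine (norm_sum_le _ _).trans (Finset.sum_le_sum fun j _ ↦ ?_)
      unfold pairTerm
      refine (norm_sub_le _ _).trans (add_le_add ?_ ?_)
      · rw [norm_mul, norm_nth_prime_cpow_neg]
        exact mul_le_of_le_one_left (Real.rpow_nonneg (nth_prime_pos_real _).le _) (P.norm_dither_le _)
      · rw [norm_mul, norm_nth_prime_cpow_neg]
        exact mul_le_of_le_one_left (Real.rpow_nonneg (nth_prime_pos_real _).le _) (P.norm_dither_le _)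
    -- `p_k^{−σ} ≤ 6/p_k`
    have h2 : ∑ k ∈ Finset.range (2 * j₀), (p[k] : ℝ) ^ (-σ) ≤
        ∑ k ∈ Finset.range (2 * j₀), 6 * (1 / (p[k] : ℝ)) := by
      refine Finset.sum_le_sum fun k hk ↦ ?_
      rw [Finset.mem_range] at hk
      have := rpow_neg_le_six_div (σ := σ) (by linarith [two_le_nth_prime_real k]) (hhead_primes k hk) hy3
        hσt
      rw [← div_eq_mul_one_div]
      exact this
    -- reindex over the primes `≤ M = ⌊2y⌋` and apply Mertens
    set M : ℕ := ⌊2 * y⌋₊ with hM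
    have hM2 : 2 ≤ M := by rw [hM]; exact Nat.le_floor (by push_cast; linarith)
    have hMy : (M : ℝ) ≤ 2 * y := Nat.floor_le (by linarith)
    have h3 : ∑ k ∈ Finset.range (2 * j₀), (1 / (p[k] : ℝ)) ≤ ∑ p ∈ Nat.primesLE M, (1 : ℝ) / p := by
      rw [← Finset.sum_image (f := fun p : ℕ ↦ (1 : ℝ) / p)
        (fun a _ b _ h ↦ (Nat.nth_strictMono Nat.infinite_setOf_prime).injective h)]
      refine Finset.sum_le_sum_of_subset_of_nonneg ?_ (fun p _ _ ↦ by positivity)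
      intro p hp
      rw [Finset.mem_image] at hp
      obtain ⟨k, hk, rfl⟩ := hp
      rw [Finset.mem_range] at hk
      rw [Nat.mem_primesLE]
      refine ⟨?_, Nat.prime_nth_prime k⟩
      rw [hM]
      exact Nat.le_floor (hhead_primes k hk)
    have h4 := Literature.NumberTheory.LFunctions.MertensBound.sum_inv_prime_le M hM2
    have h5 : Real.log (Real.log M) ≤ Real.log (Real.log (2 * |s.im| + 6)) := by
      have hM6 : (6 : ℝ) ≤ M := by
        have : (6 : ℕ) ≤ M := by rw [hM]; exact Nat.le_floor (by push_cast; linarith)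
        exact_mod_cast this
      have hlogM : 1 ≤ Real.log M := one_le_log_of_three_le (by linarith)
      refine Real.log_le_log (by linarith) (Real.log_le_log (by linarith) ?_)
      rw [hy] at hMy; linarith
    calc ‖∑ j ∈ Finset.range j₀, P.pairTerm s j‖ ≤ ∑ k ∈ Finset.range (2 * j₀), (p[k] : ℝ) ^ (-σ) := h1
      _ ≤ ∑ k ∈ Finset.range (2 * j₀), 6 * (1 / (p[k] : ℝ)) := h2
      _ = 6 * ∑ k ∈ Finset.range (2 * j₀), (1 / (p[k] : ℝ)) := by rw [Finset.mul_sum]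
      _ ≤ 6 * ∑ p ∈ Nat.primesLE M, (1 : ℝ) / p := mul_le_mul_of_nonneg_left h3 (by norm_num)
      _ ≤ 6 * (Real.log (Real.log M) + 4) := mul_le_mul_of_nonneg_left h4 (by norm_num)
      _ ≤ 6 * Real.log (Real.log (2 * |s.im| + 6)) + 24 := by linarith
  -- (3) assemble
  unfold ditherSeries
  rw [hsplit]
  calc ‖∑ j ∈ Finset.range j₀, P.pairTerm s j + ∑' j, P.pairTerm s (j + j₀)‖
      ≤ ‖∑ j ∈ Finset.range j₀, P.pairTerm s j‖ + ‖∑' j, P.pairTerm s (j + j₀)‖ := norm_add_le _ _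
    _ ≤ (6 * Real.log (Real.log (2 * |s.im| + 6)) + 24) + 22 * (1 + P.ditherLip) := add_le_add hhead htail'
    _ = _ := by ring

/-! ### Identification with the alternating prime series for `Re s > 1` -/

/-- The enumeration as an equivalence `ℕ ≃ Nat.Primes`. [folklore] -/
def nthPrimeEquiv : ℕ ≃ Nat.Primes :=
  Equiv.ofBijective (fun k ↦ ⟨p[k], Nat.prime_nth_prime k⟩)
    ⟨fun a b h ↦ (Nat.nth_strictMono Nat.infinite_setOf_prime).injective (by simpa using congrArg Subtype.val h),
     fun p ↦ ⟨Nat.count Nat.Prime p, Subtype.ext (Nat.nth_count p.prop)⟩⟩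

/-- Unfolding of `nthPrimeEquiv`. [folklore] -/
theorem nthPrimeEquiv_apply (k : ℕ) : ((nthPrimeEquiv k : Nat.Primes) : ℕ) = p[k] := rfl

/-- **The dither series is the alternating prime series**: for `Re s > 1`,
`Σ_p ± w(x_p) p^{−s} = A(s)` (the left side absolutely convergent, summed over all primes; the
signs alternate along the enumeration). [folklore] -/
theorem tsum_primes_sign_dither_eq {s : ℂ} (hs : 1 < s.re) :
    ∑' p : Nat.Primes, (sign p : ℂ) * P.dither (phase p) * ((p : ℕ) : ℂ) ^ (-s) = P.ditherSeries s := by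
  -- pass to the enumeration
  set g : ℕ → ℂ := fun k ↦ ((-1 : ℂ)) ^ k * P.dither (xk k) * ((p[k] : ℕ) : ℂ) ^ (-s) with hg
  have heq : ∀ k, (sign (nthPrimeEquiv k : Nat.Primes) : ℂ) * P.dither (phase (nthPrimeEquiv k : Nat.Primes))
      * (((nthPrimeEquiv k : Nat.Primes) : ℕ) : ℂ) ^ (-s) = g k := by
    intro k
    simp only [hg, nthPrimeEquiv_apply, sign_nth_prime, xk]
    push_cast; ring
  rw [← Equiv.tsum_eq nthPrimeEquiv]
  simp_rw [heq]
  -- `g` is absolutely summable for `Re s > 1`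
  have hgs : Summable g := by
    have hb : ∀ k, ‖g k‖ ≤ ((nthPrimeEquiv k : Nat.Primes) : ℝ) ^ (-s.re) := by
      intro k
      rw [hg]; simp only
      rw [norm_mul, norm_mul, norm_pow, norm_neg, norm_one, one_pow, one_mul, norm_nth_prime_cpow_neg,
        nthPrimeEquiv_apply]
      exact mul_le_of_le_one_left (Real.rpow_nonneg (nth_prime_pos_real _).le _) (P.norm_dither_le _)
    refine Summable.of_norm_bounded ?_ hb
    have h := (Nat.Primes.summable_rpow (r := -s.re)).2 (by linarith)
    exact (nthPrimeEquiv.summable_iff.2 h)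
  -- group in pairs
  have he : Summable fun j ↦ g (2 * j) := hgs.comp_injective (fun a b h ↦ by simpa using h)
  have ho : Summable fun j ↦ g (2 * j + 1) := hgs.comp_injective (fun a b h ↦ by simpa using h)
  rw [← tsum_even_add_odd he ho, ← he.tsum_add ho]
  refine tsum_congr fun j ↦ ?_
  rw [hg]; simp only [pairTerm]
  have h1 : ((-1 : ℂ)) ^ (2 * j) = 1 := by rw [pow_mul]; norm_num
  have h2 : ((-1 : ℂ)) ^ (2 * j + 1) = -1 := by rw [pow_succ, h1]; norm_num
  rw [h1, h2]; ring

end Profile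

end DitheredTwist

end Literature.Barriers.RiemannHypothesis

end
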